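import Summits.CriticalPhenomena.Ising3D.Control2DTaylorFree
import Summits.CriticalPhenomena.Ising3D.Control2DContinuity
import Summits.CriticalPhenomena.Ising3D.Control2DZeroDimension
import Summits.CriticalPhenomena.Ising3D.Control2DCornerAsymptotics
import Summits.CriticalPhenomena.Ising3D.Control2DCrossingPointBound
import Mathlib.Tactic.Linarith
import Mathlib.Tactic.NormNum
import HarnessLib

/-!
# The structural theorems of the typed 2D class as ONE theorem (one import for a referee)
(cell `pub-ising3x`, seat controls-1 gen 44; PAPER §6.2 / Appendix E.1h–E.1s — CONTROL-ONLY; the index of gens 42–44 in the shape of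
gen 33's `Control2DRecord` / `control2D_record`)

HONEST FRAMING: lottery ticket; floor = tightest certified 3D Ising CFT bounds; no exact-solution
claim without a proof. CONTROL-ONLY (`d = 2`, global `sl(2) × sl(2)` blocks, `Δ_σ = s` an INPUT, axiom set
`A2D′`); nothing here is about `d = 3`, no certificate, functional or number of the record is touched, and no
new hypothesis or named fact enters. NO NEW MATHEMATICS: every conjunct below is the theorem of record of its module, by name,
assembled as a term-mode tuple; `#print axioms` of `typedClass_structure` is the referee's one-line check of Appendix E.1h–E.1s
({propext, Classical.choice, Quot.sound}).

CONTROL-ONLY FENCE: statements about the control's typed class (`CrossingData.IsUnitary` + `SatisfiesCrossing s` of `Control2DBootstrap`,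
global blocks, `Δ_σ = s` an input) — nothing about any CFT and nothing about `d = 3`. NOT claimed: anything — an index; no new mathematics.

THE MAP conjunct ↦ theorem of record ↦ module (proposal id) ↦ App. E section, for
`typedClass_structure (D) (hU) (hC : SatisfiesCrossing s) (hs : 0 < s)`:
 1. `OpeConvergent` ↦ `CrossingData.opeConvergent_free` ↦ `Control2DOpeConvergenceFree` (p662777) ↦ E.1m;
 2. crossing symmetry `v^s G(z,z̄) = u^s G(1-z,1-z̄)` on `(0,1)²` ↦ `CrossingData.fourPoint_crossing_free` ↦ idem (p662777) ↦ E.1m;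
 3. `ContinuousOn G ((0,1)²)` ↦ `CrossingData.continuousOn_fourPoint_free` ↦ `Control2DContinuity` (p666975) ↦ E.1p;
 4. `∀ H, {i | p_i ≠ 0 ∧ H < Δ_i}` infinite ↦ `CrossingData.infinite_above_free` ↦ `Control2DUnboundedSpectrumFree` (p661819) ↦ E.1l;
 5. `∀ L, {i | p_i ≠ 0 ∧ L < ℓ_i}` infinite ↦ `CrossingData.infinite_spin_above_free` ↦ `Control2DOpeConvergenceFree` (p662777) ↦ E.1m;
 6. `∀ E ≥ 2s, Σ'_{Δ_i ≤ E} p_i ≤ ½ e^{2s} (E/(2s))^{2s} G(½,½)` ↦ `CrossingData.sum_p_low_le` ↦ `Control2DConvergenceRate` (p665505) ↦ E.1n;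
 7. `∀ x₀ ∈ (0,½], ∀ E ≥ 2s, Σ'_{Δ_i ≥ E} p_i g_i(x₀,x₀) ≤ e^{2s} (E/(2s))^{2s} G(½,½) x₀^E` ↦ `CrossingData.tail_le_of_le_half` ↦ idem
    (p665505) ↦ E.1n;
 8. `G(x,x) → 1 + 2 Σ'_{Δ_i = 0} p_i` at `0⁺` ↦ `CrossingData.tendsto_fourPoint_origin` ↦ `Control2DCornerAsymptotics` (p667968) ↦ E.1r;
 9. `((1-x)²)^s G(x,x) → 1 + 2 Σ'_{Δ_i = 0} p_i` at `1⁻` ↦ `CrossingData.tendsto_fourPoint_corner` ↦ idem (p667968) ↦ E.1r;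
10. every Taylor functional at a diagonal point acts termwise on the sum rule ↦ `CrossingData.hasSum_taylor_free` ↦ `Control2DTaylorFree`
    (p665591) ↦ E.1o.
`typedClass_structure_gap` (under `∀ i, τ₀ ≤ Δ_i`, `2s < τ₀`): `1 ≤ G(½,½)` ↦ `CrossingData.one_le_fourPoint` ↦ `Control2DFourPoint` (p653029)
↦ E.1h; `G(½,½) ≤ τ₀/(τ₀ - 2s)`, the universal density / tail bounds ↦ `CrossingData.fourPoint_half_le_of_lowerBound`,
`sum_p_low_le_of_lowerBound`, `tail_le_of_lowerBound` ↦ `Control2DCrossingPointBound` (p668799) ↦ E.1s; the corner constant exactly `1`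
↦ `CrossingData.tendsto_fourPoint_corner_of_pos` ↦ `Control2DCornerAsymptotics` (p667968) ↦ E.1r. `typedClass_zero`:
`SatisfiesCrossing 0 ↔ ∀ i, p_i ≠ 0 → Δ_i = 0` ↦ `CrossingData.satisfiesCrossing_zero_iff` ↦ `Control2DZeroDimension` (p667020) ↦ E.1q.
`record_structure (w)` (the record's class at `Δ_σ = 1/8`): `record_fourPoint_half_le_sharp`, `record_sum_p_low_le_sharp` ↦
`Control2DCrossingPointBound` (p668799) ↦ E.1s; `record_fourPoint_corners` ↦ `Control2DCornerAsymptotics` (p667968) ↦ E.1r;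
`continuousOn_fourPoint_eighth` ↦ `Control2DContinuity` (p666975) ↦ E.1p; `CrossingData.unbounded_spectrum_eighth` ↦
`Control2DUnboundedSpectrumFree` (p661819) ↦ E.1l; `unbounded_spin_eighth` ↦ `Control2DOpeConvergenceFree` (p662777) ↦ E.1m.

References: R. Rattazzi, V. S. Rychkov, E. Tonni, A. Vichi, JHEP 12 (2008) 031, §3 [cite: RattazziEtAl2008, §3]; D. Pappadopulo,
S. Rychkov, J. Espin, R. Rattazzi, Phys. Rev. D 86 (2012) 105043, §4 [cite: PappadopuloRychkovEspinRattazzi2012PRD, §4.2].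
-/

namespace Summit.CriticalPhenomena.Ising3D.Control2D

open Set Filter Topology
open Literature.MathematicalPhysics.QuantumFieldTheory.ConformalBootstrap3D

/-- **The structural theorems of the typed 2D class, one theorem.** For every unitary solution `D` of the typed `⟨σσσσ⟩` sum rule
at `Δ_σ = s > 0` (hypotheses: `IsUnitary`, `SatisfiesCrossing s`, `0 < s` — nothing else): (1) the `s`-channel expansion converges
absolutely on the real open square; (2) `G` is crossing-symmetric there; (3) `G` is jointly continuous there; (4) non-zero OPE
coefficients at arbitrarily high dimension and (5) at arbitrarily high spin; (6) the integrated weighted spectral density is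
`O(E^{2s})` and (7) the expansion converges geometrically, with explicit constants; (8)/(9) both corners of the diagonal have the exact
limits `1 + 2·Σ'_{Δ_i = 0} p_i` (after the crossed-channel power `((1-x)²)^s` at `1⁻`); (10) every Taylor (derivative) functional at a
diagonal point acts termwise on the sum rule. The map conjunct ↦ module ↦ App. E section is in the module docstring. CONTROL-ONLY.
[cite: RattazziEtAl2008, §3] -/
theorem typedClass_structure (D : CrossingData) (hU : D.IsUnitary) {s : ℝ} (hC : D.SatisfiesCrossing s) (hs : 0 < s) :
    D.OpeConvergent ∧
    (∀ z zb : ℝ, z ∈ Ioo (0 : ℝ) 1 → zb ∈ Ioo (0 : ℝ) 1 →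
      ((1 - z) * (1 - zb)) ^ s * D.fourPoint z zb = (z * zb) ^ s * D.fourPoint (1 - z) (1 - zb)) ∧
    ContinuousOn (fun p : ℝ × ℝ => D.fourPoint p.1 p.2) (Ioo (0 : ℝ) 1 ×ˢ Ioo (0 : ℝ) 1) ∧
    (∀ H : ℝ, {i | D.p i ≠ 0 ∧ H < D.Δ i}.Infinite) ∧
    (∀ L : ℕ, {i | D.p i ≠ 0 ∧ L < D.spin i}.Infinite) ∧
    (∀ E : ℝ, 2 * s ≤ E → ∑' i : ↥({i : D.ι | D.Δ i ≤ E} : Set D.ι), D.p i ≤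
      1 / 2 * Real.exp (2 * s) * (E / (2 * s)) ^ (2 * s) * D.fourPoint (1 / 2) (1 / 2)) ∧
    (∀ x₀ E : ℝ, 0 < x₀ → x₀ ≤ 1 / 2 → 2 * s ≤ E →
      ∑' i : ↥({i : D.ι | E ≤ D.Δ i} : Set D.ι), D.p i * globalBlock (D.Δ i) (D.spin i) x₀ x₀ ≤
        Real.exp (2 * s) * (E / (2 * s)) ^ (2 * s) * D.fourPoint (1 / 2) (1 / 2) * x₀ ^ E) ∧
    Tendsto (fun x : ℝ => D.fourPoint x x) (𝓝[>] 0) (𝓝 (1 + 2 * ∑' i : ↥({i : D.ι | D.Δ i = 0} : Set D.ι), D.p i)) ∧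
    Tendsto (fun x : ℝ => ((1 - x) * (1 - x)) ^ s * D.fourPoint x x) (𝓝[<] 1)
      (𝓝 (1 + 2 * ∑' i : ↥({i : D.ι | D.Δ i = 0} : Set D.ι), D.p i)) ∧
    (∀ (x : ℝ) (φ : (ℝ → ℝ → ℝ) →ₗ[ℝ] ℝ), IsTaylorFunctional x x φ → 0 < x → x < 1 →
      HasSum (fun i => D.p i * φ (crossF s (-1) (globalBlock (D.Δ i) (D.spin i))))
        (-(φ (crossF s (-1) (fun _ _ => (1 : ℝ)))))) :=
  ⟨CrossingData.opeConvergent_free hU hC hs,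
    fun _ _ hz hzb => CrossingData.fourPoint_crossing_free hU hC hs hz hzb,
    CrossingData.continuousOn_fourPoint_free hU hC hs,
    fun H => CrossingData.infinite_above_free hU hC hs H,
    fun L => CrossingData.infinite_spin_above_free hU hC hs L,
    fun _ hE => CrossingData.sum_p_low_le hU hC hs hE,
    fun _ _ hx₀ hx₀2 hE => CrossingData.tail_le_of_le_half hU hC hs hx₀ hx₀2 hE,
    CrossingData.tendsto_fourPoint_origin hU (CrossingData.opeConvergent_free hU hC hs),
    CrossingData.tendsto_fourPoint_corner hU hC hs,
    fun _ _ hφ hx0 hx1 => CrossingData.hasSum_taylor_free hφ hx0 hx1 hU hC hs⟩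

/-- **Under a uniform lower bound `Δ_i ≥ τ₀ > 2Δ_σ`** (a scalar gap; every class of the record): the crossing-symmetric value is bounded
by the gap, `1 ≤ G(½,½) ≤ τ₀/(τ₀ - 2s)` (E.1s), the density and rate constants are universal (E.1s), and the far corner of the diagonal is
the bare crossed-channel identity, `((1-x)²)^s G(x,x) → 1` (E.1r). [cite: RattazziEtAl2008, §3] -/
theorem typedClass_structure_gap (D : CrossingData) (hU : D.IsUnitary) {s : ℝ} (hC : D.SatisfiesCrossing s) (hs : 0 < s)
    {τ₀ : ℝ} (hτ : ∀ i, τ₀ ≤ D.Δ i) (hτ₀ : 2 * s < τ₀) :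
    (1 ≤ D.fourPoint (1 / 2) (1 / 2) ∧ D.fourPoint (1 / 2) (1 / 2) ≤ τ₀ / (τ₀ - 2 * s)) ∧
    (∀ E : ℝ, 2 * s ≤ E → ∑' i : ↥({i : D.ι | D.Δ i ≤ E} : Set D.ι), D.p i ≤
      1 / 2 * Real.exp (2 * s) * (E / (2 * s)) ^ (2 * s) * (τ₀ / (τ₀ - 2 * s))) ∧
    (∀ x₀ E : ℝ, 0 < x₀ → 2 * s ≤ E → 2 * s * x₀ ≤ E * (1 - x₀) →
      ∑' i : ↥({i : D.ι | E ≤ D.Δ i} : Set D.ι), D.p i * globalBlock (D.Δ i) (D.spin i) x₀ x₀ ≤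
        Real.exp (2 * s) * (E / (2 * s)) ^ (2 * s) * (τ₀ / (τ₀ - 2 * s)) * x₀ ^ E) ∧
    Tendsto (fun x : ℝ => ((1 - x) * (1 - x)) ^ s * D.fourPoint x x) (𝓝[<] 1) (𝓝 1) := by
  have hhalf : (1 / 2 : ℝ) ∈ Ioo (0 : ℝ) 1 := ⟨by norm_num, by norm_num⟩
  have hpos : ∀ i, D.p i ≠ 0 → 0 < D.Δ i := fun i _ => by linarith [hτ i]
  exact ⟨⟨CrossingData.one_le_fourPoint hU hhalf hhalf, CrossingData.fourPoint_half_le_of_lowerBound hU hC hτ hτ₀⟩,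
    fun _ hE => CrossingData.sum_p_low_le_of_lowerBound hU hC hs hτ hτ₀ hE,
    fun _ _ hx₀ hE hEx => CrossingData.tail_le_of_lowerBound hU hC hs hτ hτ₀ hx₀ hE hEx,
    CrossingData.tendsto_fourPoint_corner_of_pos hU hC hs hpos⟩

/-- **The edge `s = 0`** (re-export of E.1q's `satisfiesCrossing_zero_iff`): at the parameter value `s = 0` the unitary solutions of the
typed sum rule `CrossingData.SatisfiesCrossing` (as defined in `Control2DBootstrap`) are exactly the data supported on dimension-zero
scalars — the sharp form of the hypothesis `0 < s` of `typedClass_structure`. A property of the typed sum rule, not a statement about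
any CFT. [folklore] -/
theorem typedClass_zero (D : CrossingData) (hU : D.IsUnitary) :
    D.SatisfiesCrossing 0 ↔ ∀ i, D.p i ≠ 0 → D.Δ i = 0 :=
  CrossingData.satisfiesCrossing_zero_iff hU

/-- **The record's class at `Δ_σ = 1/8`, one theorem** (unitary, typed sum rule at `1/8`, spin 2 in `{2} ∪ [3,∞)`, scalars in
`{x} ∪ [2,∞)` with `w ≤ x` — the hypotheses of the record's `twoSided_2d_kernel099`): `G(½,½) ≤ 99/74` (E.1s) ∧
`Σ'_{Δ_i ≤ E} p_i ≤ (99/148) e^{1/4} (4E)^{1/4}` for `E ≥ 1/4` (E.1s) ∧ both corners of the diagonal are the bare identity (E.1r) ∧ `G`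
continuous on the open square (E.1p) ∧ non-zero OPE coefficients at arbitrarily high dimension (E.1l) and spin (E.1m). CONTROL-ONLY; no
certificate or number of the record is touched (the record enters only through the `0.99` location theorem). [folklore] -/
theorem record_structure (w : ℝ) (D : CrossingData) (hU : D.IsUnitary) (hC : D.SatisfiesCrossing (1 / 8))
    (hT : D.SpinTwoIn ({2} ∪ Ici (2 + 1))) (x : ℝ) (hwx : w ≤ x) (hS : D.ScalarsIn ({x} ∪ Ici 2)) :
    D.fourPoint (1 / 2) (1 / 2) ≤ 99 / 74 ∧
    (∀ E : ℝ, 1 / 4 ≤ E →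
      ∑' i : ↥({i : D.ι | D.Δ i ≤ E} : Set D.ι), D.p i ≤ 99 / 148 * Real.exp (1 / 4) * (4 * E) ^ (1 / 4 : ℝ)) ∧
    (Tendsto (fun y : ℝ => ((1 - y) * (1 - y)) ^ (1 / 8 : ℝ) * D.fourPoint y y) (𝓝[<] 1) (𝓝 1) ∧
      Tendsto (fun y : ℝ => D.fourPoint y y) (𝓝[>] 0) (𝓝 1)) ∧
    ContinuousOn (fun p : ℝ × ℝ => D.fourPoint p.1 p.2) (Ioo (0 : ℝ) 1 ×ˢ Ioo (0 : ℝ) 1) ∧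
    (∀ H : ℝ, {i | D.p i ≠ 0 ∧ H < D.Δ i}.Infinite) ∧
    (∀ L : ℕ, {i | D.p i ≠ 0 ∧ L < D.spin i}.Infinite) :=
  ⟨record_fourPoint_half_le_sharp w D hU hC hT x hwx hS,
    fun _ hE => record_sum_p_low_le_sharp w D hU hC hT x hwx hS hE,
    record_fourPoint_corners w D hU hC hT x hwx hS,
    continuousOn_fourPoint_eighth D hU hC,
    CrossingData.unbounded_spectrum_eighth D hU hC,
    unbounded_spin_eighth D hU hC⟩

end Summit.CriticalPhenomena.Ising3D.Control2D
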